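import Summits.BirchSwinnertonDyer.BirchSwinnertonDyer.Theorems.BiquadraticEisensteinDescentEisensteinDivisibilityCMInertBadFlatAtOneOfHeartFlat
import HarnessLib

set_option linter.dupNamespace false -- `Summit.BirchSwinnertonDyer.BirchSwinnertonDyer.Theorems.…` (summit = sub)
set_option autoImplicit false

/-!
# Crux (E♭°) of route `BiquadraticEisensteinDescent`: the ♭-heart → crux compositions with the K′ CLASS-NUMBER BINDER
# (director-bsd ruling W-16 «Δ-h⁻», 2026-08-27T15:15:08Z) — companion of `…FlatAtOneOfHeartFlat` (bed-p1 g5, p535746)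

Seat `bsd-wall-bed-p2` (prover g7, cell `pub/bsd-wall`). THEOREMS ONLY (no definition, no named fact, no `sorry`); imports no
`Theses` module (statements spelled out). The parent file states the ♭-heart `HeartFlat` and proves
`ofPrintFlat_of_heartFlat_of_absIrr : HeartFlat → AbsIrr → OfPrintFlat` with the K′-supply crux's quartic class-number
binder `(∀ L quartic ∋ √d_CM, √d_K′, ¬ p ∣ h(L)) →` carried by both `HeartFlat` and `OfPrintFlat` and merely THREADED from
the datum to the heart. Under Δ-h⁻ the supply crux KS (stmt-20198) is superseded by its K′-form («… ∧ ¬ p ∣ h(K′)»; the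
dropped conjunct is exactly «p ∤ h(ℚ(√(d_CM·d_K′)))», bed-p2 g6 p541759), so every consumer is restated with
`¬ p ∣ NumberField.classNumber K →` in the binder's slot. This file is that restatement of the parent's §3, proofs
verbatim (the parent's §1 prime avoidance and §2 unit content are imported, not restated):

* `ofPrintFlatK_of_heartFlatK_of_absIrr : HeartFlat″ → AbsIrr → OfPrintFlat″`;
* `ofPrintFlatK_of_heartFlatK : HeartFlat″ → OfPrintFlat″` ((Irr) discharged by p526727) — the `--glue-by` candidate;
* `flatAtOneK_of_heartFlatK'_of_thmB : (B) → HeartFlat′″ → E″` (E″ = item 20452's text with the K′ binder, no torsion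
  antecedent).

CONDITIONAL on the hypotheses displayed ((B) = Hsieh Doc. Math. Thm. B any level, a named fact; the ♭-heart OPEN research,
NOT IN PRINT). Supports, does not close, the E-crux. Nothing is asserted about the heart, about (B), or about BSD.

References: [Hsieh2014] M.-L. Hsieh, Doc. Math. 19 (2014), Thm. B p. 712; [Castella2018] F. Castella, arXiv:1704.06608, Thm. 3.1
p. 9; [BourbakiAC5to7] N. Bourbaki, Algèbre commutative VII §3 no. 8 Prop. 5; [GreenbergVatsal2000] p. 2 (1)–(2).
-/

noncomputable section

open scoped Classical NumberField

open PowerSeries NumberField IsDedekindDomain Field WeierstrassCurve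
  Literature.NumberTheory.EllipticCurves Literature.NumberTheory.EllipticCurves.ModularForms
  Literature.NumberTheory.EllipticCurves.Rank1Residual
  Literature.NumberTheory.GaloisRepresentations
  Literature.NumberTheory.EllipticCurves.GreenbergVatsal2000
  Literature.NumberTheory.EllipticCurves.Hida2010MuInvariant
  Literature.NumberTheory.EllipticCurves.Hsieh2014
  Literature.RingTheory.PowerSeries
  Summit.BirchSwinnertonDyer.Rank1Residual.X11b
  Summit.BirchSwinnertonDyer.Rank1Residual.X11b.AcSelmer Summit.BirchSwinnertonDyer.Rank1Residual.X11b.Halves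
  Summit.BirchSwinnertonDyer.BirchSwinnertonDyer.Theorems.BiquadraticEisensteinDescentEisensteinDivisibilityCMInertBadFlatAtOneStubE2
  Summit.BirchSwinnertonDyer.BirchSwinnertonDyer.Theorems.BiquadraticEisensteinDescentEisensteinDivisibilityCMInertBadFlatAtOneAbsIrr
  Summit.BirchSwinnertonDyer.BirchSwinnertonDyer.Theorems.BiquadraticEisensteinDescentEisensteinDivisibilityCMInertBadFlatAtOneOfHeartFlat

namespace Summit.BirchSwinnertonDyer.BirchSwinnertonDyer.Theorems.BiquadraticEisensteinDescentEisensteinDivisibilityCMInertBadFlatAtOneOfHeartFlatKPrime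

/-! ### The ♭-heart and the compositions, K′ class-number binder -/

/-- **`OfPrintFlat″` ⟸ `HeartFlat″` + `AbsIrr` (Δ-h⁻ shapes)** — `…OfHeartFlat.ofPrintFlat_of_heartFlat_of_absIrr`
(p535746) with the quartic class-number binder `(∀ L quartic, √d_CM ∈ L → √d_K′ ∈ L → ¬ p ∣ h(L)) →` replaced, in BOTH the
♭-heart hypothesis `hHeart` and the conclusion, by `¬ p ∣ NumberField.classNumber K →` (director-bsd ruling W-16: the supply
crux becomes KS_R «… ∧ p ∤ h(K′)»; the heart keeps exactly the class-number hypothesis of Hsieh's Eisenstein-congruence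
method, JAMS 27 (2014) Thm. 2 hyp. (1) `p ∤ h⁻`, read at `K′` since `h(K_CM) = 1`). The binder is only THREADED from the
conclusion's datum to `hHeart`; chain and proof verbatim: unit content of `Q` (§2 of the parent file, from (B) + (Irr)) →
`hHeart` → prime avoidance in `𝓞_{ℂ_p}⟦T⟧` (§1) → constant terms. CONDITIONAL on (B) and on the ♭-heart `hHeart` (OPEN).
[cite: Hsieh2014, Thm. B p. 712 (Doc. Math. 19)] [cite: Castella2018, Thm. 3.1 (arXiv:1704.06608 p. 9)] -/
theorem ofPrintFlatK_of_heartFlatK_of_absIrr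
    (hHeart : ∀ (W : WeierstrassCurve ℚ) [W.IsElliptic] [W.IsGloballyMinimal] (p : ℕ) [Fact p.Prime]
      [NeZero (W.conductorNorm ℤ)] (K : Type) [Field K] [NumberField K],
      W.HasCM → W.analyticRank = 1 → 5 ≤ p → CMInert W p → ¬ Good W p →
      IsImaginaryQuadratic K → SatisfiesHeegnerHypothesis (W.conductorNorm ℤ) K →
      4 < (NumberField.discr K).natAbs →
      ¬ p ∣ NumberField.classNumber K →
      (W.quadraticTwist (NumberField.discr K : ℚ)).entireLFunction 1 ≠ 0 →
      ∀ (κ : ZpExtension K p), κ.IsAnticyclotomic →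
        ∀ (γ : Field.absoluteGaloisGroup K) [Fact (κ.IsTopGenerator γ)]
          (𝔭 : HeightOneSpectrum (𝓞 K)), ((p : ℕ) : 𝓞 K) ∈ 𝔭.asIdeal →
          𝔭.asIdeal.ramificationIdx (𝓞 ℚ) = 1 → 𝔭.asIdeal.inertiaDeg (𝓞 ℚ) = 1 →
          ∀ (f : CuspForm (CongruenceSubgroup.Gamma0 (W.conductorNorm ℤ)) 2), IsNewformOf W f →
            ∀ (ι' : PadicAlgCl p ≃+* ℂ),
              (∀ (w : InfinitePlace K) (k : 𝓞 K), k ∈ 𝔭.asIdeal ↔ ‖ι'.symm (w.embedding (k : K))‖ < 1) →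
              ∀ (ΩK : ℂ) (Ωp : (unrIntegers p)ˣ) (Q : PowerSeries (PadicComplexInt p)), ΩK ≠ 0 →
                R1.IsBDPLFunctionInt p ι' 𝔭 κ γ f ΩK ((Ωp : unrIntegers p) : (PadicComplex p)) Q →
                  ∀ (𝔭' : HeightOneSpectrum (𝓞 K)), ((p : ℕ) : 𝓞 K) ∈ 𝔭'.asIdeal → 𝔭' ≠ 𝔭 →
                  Module.IsTorsion (IwasawaAlgebra p) (XAc (W.baseChange K) p κ 𝔭' ∅ γ) →
                  ∃ m : ℕ, ∀ x ∈ (XAc.charIdeal (W.baseChange K) p κ 𝔭' ∅ γ).map (PowerSeries.map (R1.toCpInt p)),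
                    (PowerSeries.C ((p : ℕ) : PadicComplexInt p) : PowerSeries (PadicComplexInt p)) ^ m * x ∈
                      Ideal.span {Q})
    (hIrr : ∀ (W : WeierstrassCurve ℚ) [W.IsElliptic] [W.IsGloballyMinimal] (p : ℕ) [Fact p.Prime]
      [NeZero (W.conductorNorm ℤ)], W.HasCM → 5 ≤ p → CMInert W p → ¬ Good W p →
      ∀ (K : Type) [Field K] [NumberField K], IsImaginaryQuadratic K →
        SatisfiesHeegnerHypothesis (W.conductorNorm ℤ) K →
        ∀ ρ : ModPGaloisRep K (ZMod p) 2, (W.baseChange K).IsTorsionGaloisRep p ρ →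
          FramedRep.IsAbsolutelyIrreducible ρ) :
  thmB_exists_isHsiehLFunction_coeff_norm_eq_one_unrPeriod_anyLevel →
  ∀ (W : WeierstrassCurve ℚ) [W.IsElliptic] [W.IsGloballyMinimal] (p : ℕ) [Fact p.Prime]
    [NeZero (W.conductorNorm ℤ)] (K : Type) [Field K] [NumberField K],
    W.HasCM → W.analyticRank = 1 → 5 ≤ p → CMInert W p → ¬ Good W p →
    IsImaginaryQuadratic K → SatisfiesHeegnerHypothesis (W.conductorNorm ℤ) K →
    4 < (NumberField.discr K).natAbs →
    ¬ p ∣ NumberField.classNumber K →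
    (W.quadraticTwist (NumberField.discr K : ℚ)).entireLFunction 1 ≠ 0 →
    ∀ (κ : ZpExtension K p), κ.IsAnticyclotomic →
      ∀ (γ : Field.absoluteGaloisGroup K) [Fact (κ.IsTopGenerator γ)]
        (𝔭 : HeightOneSpectrum (𝓞 K)), ((p : ℕ) : 𝓞 K) ∈ 𝔭.asIdeal →
        𝔭.asIdeal.ramificationIdx (𝓞 ℚ) = 1 → 𝔭.asIdeal.inertiaDeg (𝓞 ℚ) = 1 →
        ∀ (𝔭' : HeightOneSpectrum (𝓞 K)), ((p : ℕ) : 𝓞 K) ∈ 𝔭'.asIdeal → 𝔭' ≠ 𝔭 →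
        Module.IsTorsion (IwasawaAlgebra p) (XAc (W.baseChange K) p κ 𝔭' ∅ γ) →
        ∀ (f : CuspForm (CongruenceSubgroup.Gamma0 (W.conductorNorm ℤ)) 2), IsNewformOf W f →
          ∀ (ι' : PadicAlgCl p ≃+* ℂ),
            (∀ (w : InfinitePlace K) (k : 𝓞 K), k ∈ 𝔭.asIdeal ↔ ‖ι'.symm (w.embedding (k : K))‖ < 1) →
            ∀ (ΩK : ℂ) (Ωp : (unrIntegers p)ˣ) (Q : PowerSeries (PadicComplexInt p)), ΩK ≠ 0 →
              R1.IsBDPLFunctionInt p ι' 𝔭 κ γ f ΩK ((Ωp : unrIntegers p) : (PadicComplex p)) Q →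
                (XAc.charIdeal (W.baseChange K) p κ 𝔭' ∅ γ).map
                    ((R1.toCpInt p).comp (PowerSeries.constantCoeff : IwasawaAlgebra p →+* ℤ_[p])) ≤
                  Ideal.span {PowerSeries.constantCoeff Q} := by
  intro hB W _ _ p _ _ K _ _ hCM hr hp5 hin hbad hK hHN hd4 hadm hLt κ hκ γ hγ 𝔭 h𝔭 he hf 𝔭' h𝔭' hne htors f
    hfW ι' hι' ΩK Ωp Q hΩK hQ
  have hp2 : p ≠ 2 := by omega
  have hpN : p ∣ W.conductorNorm ℤ := (W.dvd_conductorNorm_iff_not_hasGoodReductionAtPrime p).mpr hbad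
  -- (E2♭) unit content of `Q`, from (B) + (Irr)
  have hQc : HasUnitContent Q :=
    hasUnitContent_of_isBDPLFunctionInt_of_thmB_anyLevel hB W hp2 hpN hfW hK hHN h𝔭 hι'
      (hIrr W p hCM hp5 hin hbad K hK hHN) hκ hγ.out hΩK (coe_units_unrIntegers_ne_zero Ωp) hQ
  -- the ♭-heart: containment up to `p^m`
  obtain ⟨m, hm⟩ := hHeart W p K hCM hr hp5 hin hbad hK hHN hd4 hadm hLt κ hκ γ 𝔭 h𝔭 he hf f hfW ι' hι' ΩK Ωp
    Q hΩK hQ 𝔭' h𝔭' hne htors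
  -- (E3♭) prime avoidance
  have hflat : (XAc.charIdeal (W.baseChange K) p κ 𝔭' ∅ γ).map (PowerSeries.map (R1.toCpInt p)) ≤
      Ideal.span {Q} := le_span_of_forall_C_pow_mul_mem hQc hm
  -- constant terms
  have hcc : ∀ g : IwasawaAlgebra p, PowerSeries.constantCoeff (PowerSeries.map (R1.toCpInt p) g) =
      R1.toCpInt p (PowerSeries.constantCoeff g) := fun g ↦ by
    rw [← PowerSeries.coeff_zero_eq_constantCoeff_apply, PowerSeries.coeff_map,
      PowerSeries.coeff_zero_eq_constantCoeff_apply]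
  have hcomp : (R1.toCpInt p).comp (PowerSeries.constantCoeff : IwasawaAlgebra p →+* ℤ_[p]) =
      (PowerSeries.constantCoeff : PowerSeries 𝓞_ℂ_[p] →+* 𝓞_ℂ_[p]).comp (PowerSeries.map (R1.toCpInt p)) := by
    ext g
    simp [hcc]
  rw [hcomp, ← Ideal.map_map]
  refine (Ideal.map_mono hflat).trans ?_
  rw [Ideal.map_span, Set.image_singleton]

/-- **`OfPrintFlat″` ⟸ `HeartFlat″` ALONE (Δ-h⁻ shapes)**: `ofPrintFlatK_of_heartFlatK_of_absIrr` with (Irr) DISCHARGED by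
the theorem `…FlatAtOneAbsIrr.absIrrModPBaseChangeCMInert` (p526727). The `--glue-by` candidate for a promoted ♭-heart
with the K′ class-number binder. CONDITIONAL on the ♭-heart (OPEN) and on (B) in the conclusion's antecedent.
[cite: Hsieh2014, Thm. B p. 712 (Doc. Math. 19)] -/
theorem ofPrintFlatK_of_heartFlatK
    (hHeart : ∀ (W : WeierstrassCurve ℚ) [W.IsElliptic] [W.IsGloballyMinimal] (p : ℕ) [Fact p.Prime]
      [NeZero (W.conductorNorm ℤ)] (K : Type) [Field K] [NumberField K],
      W.HasCM → W.analyticRank = 1 → 5 ≤ p → CMInert W p → ¬ Good W p →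
      IsImaginaryQuadratic K → SatisfiesHeegnerHypothesis (W.conductorNorm ℤ) K →
      4 < (NumberField.discr K).natAbs →
      ¬ p ∣ NumberField.classNumber K →
      (W.quadraticTwist (NumberField.discr K : ℚ)).entireLFunction 1 ≠ 0 →
      ∀ (κ : ZpExtension K p), κ.IsAnticyclotomic →
        ∀ (γ : Field.absoluteGaloisGroup K) [Fact (κ.IsTopGenerator γ)]
          (𝔭 : HeightOneSpectrum (𝓞 K)), ((p : ℕ) : 𝓞 K) ∈ 𝔭.asIdeal →
          𝔭.asIdeal.ramificationIdx (𝓞 ℚ) = 1 → 𝔭.asIdeal.inertiaDeg (𝓞 ℚ) = 1 →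
          ∀ (f : CuspForm (CongruenceSubgroup.Gamma0 (W.conductorNorm ℤ)) 2), IsNewformOf W f →
            ∀ (ι' : PadicAlgCl p ≃+* ℂ),
              (∀ (w : InfinitePlace K) (k : 𝓞 K), k ∈ 𝔭.asIdeal ↔ ‖ι'.symm (w.embedding (k : K))‖ < 1) →
              ∀ (ΩK : ℂ) (Ωp : (unrIntegers p)ˣ) (Q : PowerSeries (PadicComplexInt p)), ΩK ≠ 0 →
                R1.IsBDPLFunctionInt p ι' 𝔭 κ γ f ΩK ((Ωp : unrIntegers p) : (PadicComplex p)) Q →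
                  ∀ (𝔭' : HeightOneSpectrum (𝓞 K)), ((p : ℕ) : 𝓞 K) ∈ 𝔭'.asIdeal → 𝔭' ≠ 𝔭 →
                  Module.IsTorsion (IwasawaAlgebra p) (XAc (W.baseChange K) p κ 𝔭' ∅ γ) →
                  ∃ m : ℕ, ∀ x ∈ (XAc.charIdeal (W.baseChange K) p κ 𝔭' ∅ γ).map (PowerSeries.map (R1.toCpInt p)),
                    (PowerSeries.C ((p : ℕ) : PadicComplexInt p) : PowerSeries (PadicComplexInt p)) ^ m * x ∈
                      Ideal.span {Q}) :
  thmB_exists_isHsiehLFunction_coeff_norm_eq_one_unrPeriod_anyLevel →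
  ∀ (W : WeierstrassCurve ℚ) [W.IsElliptic] [W.IsGloballyMinimal] (p : ℕ) [Fact p.Prime]
    [NeZero (W.conductorNorm ℤ)] (K : Type) [Field K] [NumberField K],
    W.HasCM → W.analyticRank = 1 → 5 ≤ p → CMInert W p → ¬ Good W p →
    IsImaginaryQuadratic K → SatisfiesHeegnerHypothesis (W.conductorNorm ℤ) K →
    4 < (NumberField.discr K).natAbs →
    ¬ p ∣ NumberField.classNumber K →
    (W.quadraticTwist (NumberField.discr K : ℚ)).entireLFunction 1 ≠ 0 →
    ∀ (κ : ZpExtension K p), κ.IsAnticyclotomic →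
      ∀ (γ : Field.absoluteGaloisGroup K) [Fact (κ.IsTopGenerator γ)]
        (𝔭 : HeightOneSpectrum (𝓞 K)), ((p : ℕ) : 𝓞 K) ∈ 𝔭.asIdeal →
        𝔭.asIdeal.ramificationIdx (𝓞 ℚ) = 1 → 𝔭.asIdeal.inertiaDeg (𝓞 ℚ) = 1 →
        ∀ (𝔭' : HeightOneSpectrum (𝓞 K)), ((p : ℕ) : 𝓞 K) ∈ 𝔭'.asIdeal → 𝔭' ≠ 𝔭 →
        Module.IsTorsion (IwasawaAlgebra p) (XAc (W.baseChange K) p κ 𝔭' ∅ γ) →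
        ∀ (f : CuspForm (CongruenceSubgroup.Gamma0 (W.conductorNorm ℤ)) 2), IsNewformOf W f →
          ∀ (ι' : PadicAlgCl p ≃+* ℂ),
            (∀ (w : InfinitePlace K) (k : 𝓞 K), k ∈ 𝔭.asIdeal ↔ ‖ι'.symm (w.embedding (k : K))‖ < 1) →
            ∀ (ΩK : ℂ) (Ωp : (unrIntegers p)ˣ) (Q : PowerSeries (PadicComplexInt p)), ΩK ≠ 0 →
              R1.IsBDPLFunctionInt p ι' 𝔭 κ γ f ΩK ((Ωp : unrIntegers p) : (PadicComplex p)) Q →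
                (XAc.charIdeal (W.baseChange K) p κ 𝔭' ∅ γ).map
                    ((R1.toCpInt p).comp (PowerSeries.constantCoeff : IwasawaAlgebra p →+* ℤ_[p])) ≤
                  Ideal.span {PowerSeries.constantCoeff Q} :=
  ofPrintFlatK_of_heartFlatK_of_absIrr hHeart absIrrModPBaseChangeCMInert

/-- **E″ = the crux (E♭°) with the K′ class-number binder and no torsion binder ⟸ (B) + the torsion-free ♭-heart
`HeartFlat′″`** (= the parent file's `flatAtOne_of_heartFlat'_of_thmB` with the quartic binder ↦ `¬ p ∣ h(K′) →` in
hypothesis and conclusion). Recorded to show what the Δ-h⁻ text of item 20452 costs if it is restated WITHOUT the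
Λ-torsion antecedent: exactly (B) beyond `HeartFlat′″`. CONDITIONAL on (B) and on `HeartFlat′″` (OPEN).
[cite: Hsieh2014, Thm. B p. 712 (Doc. Math. 19)] -/
theorem flatAtOneK_of_heartFlatK'_of_thmB
    (hB : thmB_exists_isHsiehLFunction_coeff_norm_eq_one_unrPeriod_anyLevel)
    (hHeart : ∀ (W : WeierstrassCurve ℚ) [W.IsElliptic] [W.IsGloballyMinimal] (p : ℕ) [Fact p.Prime]
      [NeZero (W.conductorNorm ℤ)] (K : Type) [Field K] [NumberField K],
      W.HasCM → W.analyticRank = 1 → 5 ≤ p → CMInert W p → ¬ Good W p →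
      IsImaginaryQuadratic K → SatisfiesHeegnerHypothesis (W.conductorNorm ℤ) K →
      4 < (NumberField.discr K).natAbs →
      ¬ p ∣ NumberField.classNumber K →
      (W.quadraticTwist (NumberField.discr K : ℚ)).entireLFunction 1 ≠ 0 →
      ∀ (κ : ZpExtension K p), κ.IsAnticyclotomic →
        ∀ (γ : Field.absoluteGaloisGroup K) [Fact (κ.IsTopGenerator γ)]
          (𝔭 : HeightOneSpectrum (𝓞 K)), ((p : ℕ) : 𝓞 K) ∈ 𝔭.asIdeal →
          𝔭.asIdeal.ramificationIdx (𝓞 ℚ) = 1 → 𝔭.asIdeal.inertiaDeg (𝓞 ℚ) = 1 →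
          ∀ (f : CuspForm (CongruenceSubgroup.Gamma0 (W.conductorNorm ℤ)) 2), IsNewformOf W f →
            ∀ (ι' : PadicAlgCl p ≃+* ℂ),
              (∀ (w : InfinitePlace K) (k : 𝓞 K), k ∈ 𝔭.asIdeal ↔ ‖ι'.symm (w.embedding (k : K))‖ < 1) →
              ∀ (ΩK : ℂ) (Ωp : (unrIntegers p)ˣ) (Q : PowerSeries (PadicComplexInt p)), ΩK ≠ 0 →
                R1.IsBDPLFunctionInt p ι' 𝔭 κ γ f ΩK ((Ωp : unrIntegers p) : (PadicComplex p)) Q →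
                  ∀ (𝔭' : HeightOneSpectrum (𝓞 K)), ((p : ℕ) : 𝓞 K) ∈ 𝔭'.asIdeal → 𝔭' ≠ 𝔭 →
                  ∃ m : ℕ, ∀ x ∈ (XAc.charIdeal (W.baseChange K) p κ 𝔭' ∅ γ).map (PowerSeries.map (R1.toCpInt p)),
                    (PowerSeries.C ((p : ℕ) : PadicComplexInt p) : PowerSeries (PadicComplexInt p)) ^ m * x ∈
                      Ideal.span {Q}) :
  ∀ (W : WeierstrassCurve ℚ) [W.IsElliptic] [W.IsGloballyMinimal] (p : ℕ) [Fact p.Prime]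
    [NeZero (W.conductorNorm ℤ)] (K : Type) [Field K] [NumberField K],
    W.HasCM → W.analyticRank = 1 → 5 ≤ p → CMInert W p → ¬ Good W p →
    IsImaginaryQuadratic K → SatisfiesHeegnerHypothesis (W.conductorNorm ℤ) K →
    4 < (NumberField.discr K).natAbs →
    ¬ p ∣ NumberField.classNumber K →
    (W.quadraticTwist (NumberField.discr K : ℚ)).entireLFunction 1 ≠ 0 →
    ∀ (κ : ZpExtension K p), κ.IsAnticyclotomic →
      ∀ (γ : Field.absoluteGaloisGroup K) [Fact (κ.IsTopGenerator γ)]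
        (𝔭 : HeightOneSpectrum (𝓞 K)), ((p : ℕ) : 𝓞 K) ∈ 𝔭.asIdeal →
        𝔭.asIdeal.ramificationIdx (𝓞 ℚ) = 1 → 𝔭.asIdeal.inertiaDeg (𝓞 ℚ) = 1 →
        ∀ (𝔭' : HeightOneSpectrum (𝓞 K)), ((p : ℕ) : 𝓞 K) ∈ 𝔭'.asIdeal → 𝔭' ≠ 𝔭 →
        ∀ (f : CuspForm (CongruenceSubgroup.Gamma0 (W.conductorNorm ℤ)) 2), IsNewformOf W f →
          ∀ (ι' : PadicAlgCl p ≃+* ℂ),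
            (∀ (w : InfinitePlace K) (k : 𝓞 K), k ∈ 𝔭.asIdeal ↔ ‖ι'.symm (w.embedding (k : K))‖ < 1) →
            ∀ (ΩK : ℂ) (Ωp : (unrIntegers p)ˣ) (Q : PowerSeries (PadicComplexInt p)), ΩK ≠ 0 →
              R1.IsBDPLFunctionInt p ι' 𝔭 κ γ f ΩK ((Ωp : unrIntegers p) : (PadicComplex p)) Q →
                (XAc.charIdeal (W.baseChange K) p κ 𝔭' ∅ γ).map
                    ((R1.toCpInt p).comp (PowerSeries.constantCoeff : IwasawaAlgebra p →+* ℤ_[p])) ≤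
                  Ideal.span {PowerSeries.constantCoeff Q} := by
  intro W _ _ p _ _ K _ _ hCM hr hp5 hin hbad hK hHN hd4 hadm hLt κ hκ γ hγ 𝔭 h𝔭 he hf 𝔭' h𝔭' hne f hfW ι' hι'
    ΩK Ωp Q hΩK hQ
  have hp2 : p ≠ 2 := by omega
  have hpN : p ∣ W.conductorNorm ℤ := (W.dvd_conductorNorm_iff_not_hasGoodReductionAtPrime p).mpr hbad
  have hQc : HasUnitContent Q :=
    hasUnitContent_of_isBDPLFunctionInt_of_thmB_anyLevel hB W hp2 hpN hfW hK hHN h𝔭 hι'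
      (absIrrModPBaseChangeCMInert W p hCM hp5 hin hbad K hK hHN) hκ hγ.out hΩK (coe_units_unrIntegers_ne_zero Ωp) hQ
  obtain ⟨m, hm⟩ := hHeart W p K hCM hr hp5 hin hbad hK hHN hd4 hadm hLt κ hκ γ 𝔭 h𝔭 he hf f hfW ι' hι' ΩK Ωp
    Q hΩK hQ 𝔭' h𝔭' hne
  have hflat : (XAc.charIdeal (W.baseChange K) p κ 𝔭' ∅ γ).map (PowerSeries.map (R1.toCpInt p)) ≤
      Ideal.span {Q} := le_span_of_forall_C_pow_mul_mem hQc hm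
  have hcc : ∀ g : IwasawaAlgebra p, PowerSeries.constantCoeff (PowerSeries.map (R1.toCpInt p) g) =
      R1.toCpInt p (PowerSeries.constantCoeff g) := fun g ↦ by
    rw [← PowerSeries.coeff_zero_eq_constantCoeff_apply, PowerSeries.coeff_map,
      PowerSeries.coeff_zero_eq_constantCoeff_apply]
  have hcomp : (R1.toCpInt p).comp (PowerSeries.constantCoeff : IwasawaAlgebra p →+* ℤ_[p]) =
      (PowerSeries.constantCoeff : PowerSeries 𝓞_ℂ_[p] →+* 𝓞_ℂ_[p]).comp (PowerSeries.map (R1.toCpInt p)) := by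
    ext g
    simp [hcc]
  rw [hcomp, ← Ideal.map_map]
  refine (Ideal.map_mono hflat).trans ?_
  rw [Ideal.map_span, Set.image_singleton]

end Summit.BirchSwinnertonDyer.BirchSwinnertonDyer.Theorems.BiquadraticEisensteinDescentEisensteinDivisibilityCMInertBadFlatAtOneOfHeartFlatKPrime

end
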